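import Mathlib
import Summits.NavierStokesRegularity.NavierStokesRegularity.Theorems.FilamentSkeletonRssStadiumOwnFarKernel

/-!
# The numerical constants of the retyped contour (`TangentSkeletonNearStraightL`, stmt-NavierStokesRegularity-23320, registered stub
# `stub_stripPropagation` — discharging the hypotheses `hA`, `hC` of Theorems.StadiumContourPositivityAbs / StadiumBaseMargin / StadiumPlateauPiece /
# StadiumConnectorPiece / StadiumSourceRegionTwo for disc ratio `n = 8`, `M = 2`, slopes `m ≤ 2/7`, every `Rb ≤ 1/2`)

`log(8/7) ≤ 0.134` (`1 + x + x²/2 ≤ eˣ`), `√3 ≤ 7/4`; hence with `E = √3·2M(log(8/7) − 1/8) ≤ 0.063`, `Q = √3·M·log(8/7) ≤ 0.469`: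
`A₁ = 1 − (Rb + 2E)²/2 ≥ 0.80` (`ratio8_A_pos`) and the slope coefficient `(1 − m²)A₁ − 2m·2Q(Rb + 2E) ≥ 3/8 > 0` for `m ≤ 2/7` (`ratio8_slope_pos`),
for all `0 ≤ Rb ≤ 1/2`.  These are the ONLY numerical facts the assembly R4–R7 of `DIAG-addendum-contour-g2.md` needs (besides `9·hs' ≤ hs`-type
geometry).  HONEST FRAMING: arithmetic for a HYPOTHETICAL filament skeleton on the NEGATIVE side of a MODEL route; nothing here bears on Navier–Stokes
regularity or blow-up.  `--supports stmt-NavierStokesRegularity-23320`.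
-/

set_option linter.dupNamespace false

noncomputable section

namespace Summit.NavierStokesRegularity.NavierStokesRegularity.Theorems.StadiumConstants

/-- `log(8/7) ≤ 0.134`. [folklore] -/
theorem log_eight_sevenths_le : Real.log (8 / 7) ≤ 134 / 1000 := by
  have h : (8:ℝ) / 7 ≤ Real.exp (134 / 1000) := by
    have := Real.quadratic_le_exp_of_nonneg (show (0:ℝ) ≤ 134 / 1000 by norm_num)
    exact le_trans (by norm_num) this
  have := Real.log_le_log (by norm_num : (0:ℝ) < 8 / 7) h
  rwa [Real.log_exp] at this

/-- `1/8 ≤ log(8/7)`. [folklore] -/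
theorem eighth_le_log_eight_sevenths : 1 / 8 ≤ Real.log (8 / 7) := by
  have h := Real.one_sub_inv_le_log_of_pos (show (0:ℝ) < 8 / 7 by norm_num)
  norm_num at h ⊢; linarith

/-- `log(8/(8−1)) = log(8/7)` in the form produced by the ratio lemmas. [folklore] -/
theorem log_ratio_eight : Real.log ((8:ℝ) / (8 - 1)) = Real.log (8 / 7) := by norm_num

/-- The real-deviation constant at ratio 8, `M = 2`: `E = √3·(2·2·(log(8/7) − 1/8)) ≤ 63/1000`. [folklore] -/
theorem E_le : √3 * (2 * 2 * (Real.log ((8:ℝ) / (8 - 1)) - 1 / 8)) ≤ 63 / 1000 := by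
  rw [log_ratio_eight]
  have h1 := log_eight_sevenths_le
  have h2 := eighth_le_log_eight_sevenths
  have h3 := Summit.NavierStokesRegularity.NavierStokesRegularity.Theorems.StadiumOwnFarKernel.sqrt_three_le
  have h0 : 0 ≤ √(3:ℝ) := Real.sqrt_nonneg _
  have h4 : 0 ≤ 2 * 2 * (Real.log (8 / 7) - 1 / 8) := by linarith
  calc √3 * (2 * 2 * (Real.log (8 / 7) - 1 / 8)) ≤ 7 / 4 * (2 * 2 * (134 / 1000 - 1 / 8)) :=
        mul_le_mul h3 (by linarith) h4 (by norm_num)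
    _ = 63 / 1000 := by norm_num

/-- `0 ≤ E`. [folklore] -/
theorem E_nonneg : 0 ≤ √3 * (2 * 2 * (Real.log ((8:ℝ) / (8 - 1)) - 1 / 8)) := by
  rw [log_ratio_eight]
  have h2 := eighth_le_log_eight_sevenths
  have h0 : 0 ≤ √(3:ℝ) := Real.sqrt_nonneg _
  exact mul_nonneg h0 (by linarith)

/-- The imaginary-deviation constant at ratio 8, `M = 2`: `Q = √3·(2·log(8/7)) ≤ 469/1000`. [folklore] -/
theorem Q_le : √3 * (2 * Real.log ((8:ℝ) / (8 - 1))) ≤ 469 / 1000 := by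
  rw [log_ratio_eight]
  have h1 := log_eight_sevenths_le
  have h3 := Summit.NavierStokesRegularity.NavierStokesRegularity.Theorems.StadiumOwnFarKernel.sqrt_three_le
  have h0 : 0 ≤ √(3:ℝ) := Real.sqrt_nonneg _
  have h4 : 0 ≤ 2 * Real.log (8 / 7) := by linarith [eighth_le_log_eight_sevenths]
  calc √3 * (2 * Real.log (8 / 7)) ≤ 7 / 4 * (2 * (134 / 1000)) := mul_le_mul h3 (by linarith) h4 (by norm_num)
    _ = 469 / 1000 := by norm_num

/-- `0 ≤ Q`. [folklore] -/
theorem Q_nonneg : 0 ≤ √3 * (2 * Real.log ((8:ℝ) / (8 - 1))) := by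
  rw [log_ratio_eight]
  exact mul_nonneg (Real.sqrt_nonneg _) (by linarith [eighth_le_log_eight_sevenths])

/-- **`hA` at ratio 8**: `A₁ = 1 − (Rb + 2E)²/2 ≥ 4/5` for `0 ≤ Rb ≤ 1/2`. [folklore] -/
theorem ratio8_A_ge {Rb : ℝ} (hRb0 : 0 ≤ Rb) (hRb : Rb ≤ 1 / 2) :
    4 / 5 ≤ 1 - (Rb + 2 * (√3 * (2 * 2 * (Real.log ((8:ℝ) / (8 - 1)) - 1 / 8)))) ^ 2 / 2 := by
  have hE := E_le
  have hE0 := E_nonneg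
  set E := √3 * (2 * 2 * (Real.log ((8:ℝ) / (8 - 1)) - 1 / 8)) with hEdef
  have h1 : Rb + 2 * E ≤ 1 / 2 + 126 / 1000 := by linarith
  have h2 : 0 ≤ Rb + 2 * E := by linarith
  have h3 : (Rb + 2 * E) ^ 2 ≤ (1 / 2 + 126 / 1000) ^ 2 := pow_le_pow_left₀ h2 h1 2
  nlinarith

/-- **`hC` at ratio 8, slope `m ≤ 2/7`**: the slope coefficient is `≥ 3/8 > 0` for `0 ≤ Rb ≤ 1/2`. [folklore] -/
theorem ratio8_slope_ge {Rb m : ℝ} (hRb0 : 0 ≤ Rb) (hRb : Rb ≤ 1 / 2) (hm0 : 0 ≤ m) (hm : m ≤ 2 / 7) :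
    3 / 8 ≤ (1 - m ^ 2) * (1 - (Rb + 2 * (√3 * (2 * 2 * (Real.log ((8:ℝ) / (8 - 1)) - 1 / 8)))) ^ 2 / 2) -
      2 * m * (2 * (√3 * (2 * Real.log ((8:ℝ) / (8 - 1)))) * (Rb + 2 * (√3 * (2 * 2 * (Real.log ((8:ℝ) / (8 - 1)) - 1 / 8))))) := by
  have hE := E_le
  have hE0 := E_nonneg
  have hQ := Q_le
  have hQ0 := Q_nonneg
  set E := √3 * (2 * 2 * (Real.log ((8:ℝ) / (8 - 1)) - 1 / 8)) with hEdef
  set Q := √3 * (2 * Real.log ((8:ℝ) / (8 - 1))) with hQdef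
  have hA := ratio8_A_ge hRb0 hRb
  rw [← hEdef] at hA
  set A₁ := 1 - (Rb + 2 * E) ^ 2 / 2 with hA₁
  have hA1 : A₁ ≤ 1 := by have : 0 ≤ (Rb + 2 * E) ^ 2 := sq_nonneg _; linarith
  have hRE : Rb + 2 * E ≤ 626 / 1000 := by linarith
  have hRE0 : 0 ≤ Rb + 2 * E := by linarith
  -- `(1 − m²) A₁ ≥ (1 − 4/49)·(4/5)` and `2m·(2Q(Rb+2E)) ≤ (4/7)·(2·0.469·0.626)`
  have h1 : (1 - (2 / 7) ^ 2) * (4 / 5) ≤ (1 - m ^ 2) * A₁ := by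
    have hm2 : m ^ 2 ≤ (2 / 7) ^ 2 := pow_le_pow_left₀ hm0 hm 2
    have : 0 ≤ 1 - m ^ 2 := by nlinarith
    nlinarith
  have h2 : 2 * m * (2 * Q * (Rb + 2 * E)) ≤ 2 * (2 / 7) * (2 * (469 / 1000) * (626 / 1000)) := by
    have hQR : Q * (Rb + 2 * E) ≤ 469 / 1000 * (626 / 1000) := mul_le_mul hQ hRE hRE0 (by norm_num)
    have hQR0 : 0 ≤ Q * (Rb + 2 * E) := mul_nonneg hQ0 hRE0
    nlinarith
  nlinarith

/-- The literal hypothesis `hA` (`0 ≤ A₁`) at ratio 8, `M = 2`, `0 ≤ Rb ≤ 1/2`. [folklore] -/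
theorem ratio8_hA {Rb : ℝ} (hRb0 : 0 ≤ Rb) (hRb : Rb ≤ 1 / 2) :
    0 ≤ 1 - (Rb + 2 * (√3 * (2 * 2 * (Real.log ((8:ℝ) / (8 - 1)) - 1 / 8)))) ^ 2 / 2 :=
  le_trans (by norm_num) (ratio8_A_ge hRb0 hRb)

/-- The literal hypothesis `hC` (`0 <` slope coefficient) at ratio 8, `M = 2`, `m ≤ 2/7`, `0 ≤ Rb ≤ 1/2`. [folklore] -/
theorem ratio8_hC {Rb m : ℝ} (hRb0 : 0 ≤ Rb) (hRb : Rb ≤ 1 / 2) (hm0 : 0 ≤ m) (hm : m ≤ 2 / 7) :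
    0 < (1 - m ^ 2) * (1 - (Rb + 2 * (√3 * (2 * 2 * (Real.log ((8:ℝ) / (8 - 1)) - 1 / 8)))) ^ 2 / 2) -
      2 * m * (2 * (√3 * (2 * Real.log ((8:ℝ) / (8 - 1)))) * (Rb + 2 * (√3 * (2 * 2 * (Real.log ((8:ℝ) / (8 - 1)) - 1 / 8))))) :=
  lt_of_lt_of_le (by norm_num) (ratio8_slope_ge hRb0 hRb hm0 hm)

end Summit.NavierStokesRegularity.NavierStokesRegularity.Theorems.StadiumConstants

end
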